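import Summits.BirchSwinnertonDyer.Rank1Residual.Additive.CyclotomicInertiaSqrtPStar
import Summits.BirchSwinnertonDyer.Rank1Residual.Additive.CorankOneFiniteOrderAutomorphism
import Summits.BirchSwinnertonDyer.Rank1Residual.X2.GreenbergVatsalTorsionCurve
import Summits.BirchSwinnertonDyer.Rank1Residual.X2.TorsionComparison
import Literature.NumberTheory.GaloisRepresentations.InertiaPadicCharacterProofs
import HarnessLib

/-!
# GV Remark (2.9)'s hypothesis `(E[p^∞]/C)^{ker κ ⊓ I_v} = 0` — MODEL-FREE, for EVERY ramified
# ordinary line (any `E/ℚ`, any odd `p`, any `ℤ_p`-extension `κ`) (cell `b2b-bsdres`, team n1011,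
# seat p12 (gen 6); row T-GV29-MF; discharges the displayed binder `h0` of
# `GreenbergVatsalTorsionRamifiedQuotient` / `GreenbergVatsalTransferRamifiedQuotient` /
# `GreenbergVatsalTransferMatching` for every datum, in particular on the `e ∈ {3,4,6}` rows)

HONEST FRAMING (cell `b2b-bsdres`, run/shared/lean/b2b/bsd-rank1-residual/, verbatim in every
file): the goal of the cell is to DELETE the COMBINATION-SHAPED residual classes of the
Birch–Swinnerton-Dyer formula for ALL analytic-rank `≤ 1` elliptic curves over `ℚ` — "full BSD
formula for every rank `≤ 1` curve in class `C`" assembled STRICTLY from published theorems — so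
that the rank-`≤ 1` remainder becomes exactly the CONSTRUCTION-SHAPED classes, which are TYPED
(missing-input `Prop`s), NOT attempted. This is not "finishing BSD". Team n1011: research routes on
CONSTRUCTION-SHAPED classes; prove what is provable now; no claim beyond stated classes; census
output = EVIDENCE, never a Literature fact; RESIDUAL-MAP marks UNCHANGED; nothing is booked by this
file. THEOREMS ONLY: no definition, no named fact; cc-typer-1's predicate `IsRamifiedOrdinaryLine`,
cc-typer-2's generator lemmas, p07's `natCard_plus_inf_torsionBy_eq` and the gen-4 κ-image lemma are
consumed BY NAME and untouched.

## What and why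

Greenberg–Vatsal's torsion comparison `S_{A[p]} = S_A[p]` (Prop. (2.8)) is printed for `I_p` acting
trivially on `D = A/C`; Remark (2.9): "all that is needed in the proof is that `H⁰(I_p, D)` is
divisible. Thus, if `D^{I_p} = 0`, the conclusion is still true." The cell's kernel version
(`GreenbergVatsalTorsionRamifiedQuotient`, gen 4) carries this as the displayed binder
`h0 : ∀ a ∈ invariants (inertiaIn H v) L.Gr, a = 0` for `H = ker κ` (the inertia group of the TOP of
the `ℤ_p`-tower at the chosen prime above `v`). So far `h0` was discharged only on the four `e = 2`
loci (X4♯(G-ord, `e = 2`) / X3♯(G-ord) / X4(M) / X3♯(M): gen 4 `RamifiedOrdinaryLineQuotientInvariants`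
by the explicit `−1` of `√p*`, gen 5 `GreenbergVatsalTransferMatching` for every line there via
cc-typer-2's uniqueness). THIS FILE proves `h0` from the predicate `IsRamifiedOrdinaryLine W p L`
ALONE — `C = L.plus` divisible, `≠ E[p^∞]`, `≠ 0`, inertia acting on `E[p^∞]/C` through a finite
quotient, non-trivially — for EVERY elliptic `E/ℚ`, EVERY odd `p`, EVERY `ℤ_p`-extension `κ`; in
particular on the (G-ord, `e ∈ {3,4,6}`) rows (team row T-ROL-G constructs the line there) with no
further input.

* the GENERIC `p`-group algebra is FILE A1 `CorankOneFiniteOrderAutomorphism` (same row): for a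
  group `G` acting on a `p`-primary `D`, (L1) `(g − 1)` injective on `D[p]` ⇒ `D^g = 0`; (L4) for
  `p` ODD and `D` `p`-divisible with `#D[p] = p`, an element trivial on `D[p]` with `gⁿ = 1`
  (`n ≥ 1`) is trivial on `D` (prime-to-`p` part by induction on the level, `p`-part by lifting the
  exponent on the scalar of a generator of the cyclic `D[p^K]`); and with `#D[p] = p` an element
  moving one `p`-torsion point fixes no non-zero `p`-torsion point;
* §1 THE QUOTIENT `D = E[p^∞]/C` of a ramified ordinary line: `p`-primary, `p`-divisible, and
  `natCard_torsionBy_gr : #D[p] = p` (`E[p^∞][p] ↠ D[p]` with kernel `C ∩ E[p^∞][p]` of order `p`).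
* §2 `exists_inertia_smul_torsionBy_ne` — clause 5's inertia element acts NON-trivially on `D[p]`
  (else FILE A1's (L4) + clause 4 make it trivial on `D`); `exists_inertia_mem_kerSubgroup_smul_torsionBy_ne` —
  moved INSIDE `ker κ` keeping its action on `D[p]`: `τ = σ₀ σ₁^{−(p−1)}` with
  `(p−1)·κ(res σ₁) = κ(res σ₀)` (gen-4 `exists_mem_absInertia_toAdd_eq_mul`: the image of `I_{ℚ_v}`
  in `ℤ_p` is a `ℤ_p`-submodule; `p − 1 ∈ ℤ_pˣ`; `σ₁^{p−1}` fixes the cyclic `D[p]` by Fermat);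
  **MAIN `gr_invariants_eq_zero_of_isRamifiedOrdinaryLine (hp2) (hL) (κ) :
  ∀ a ∈ invariants (inertiaIn κ.kerSubgroup v) L.Gr, a = 0`**, and the `Data`-family form
  `data_gr_invariants_eq_zero_of_isRamifiedOrdinaryLine` (the shape of the binder `h0` in the
  transfer files).

No hypothesis on the place `v`, the reduction type, the semistability defect, the image of `ρ̄`,
twist models or Tate uniformisation; `κ` is any `ℤ_p`-extension of `ℚ`. The gen-5 class forms
`ClassX4Gord/ClassX3Gord/PotMult/ClassX4M/ClassX3M.gr_invariants_eq_zero_of_isRamifiedOrdinaryLine`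
are special cases (those declarations are untouched).

References: [GreenbergVatsal2000] §2 Prop. (2.8), Remark (2.9) (arXiv:math/9906215 pp. 25–26);
[EmertonPollackWeston2006] §3.1 (eq:ordes); Serre, *Cours d'arithmétique* II §3 / Washington GTM 83
§13.1 (structure of `ℤ_pˣ`; here replaced by kernel algebra on `D`).
-/

set_option autoImplicit false

noncomputable section

open scoped Classical NumberField AddSubgroup

open NumberField IsDedekindDomain Field WeierstrassCurve
  Literature.NumberTheory.GaloisRepresentations Literature.NumberTheory.EllipticCurves
  Literature.NumberTheory.EllipticCurves.GreenbergSelmer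
  Literature.NumberTheory.EllipticCurves.EmertonPollackWeston2006
  Summit.BirchSwinnertonDyer.Rank1Residual.X2.TorsionComparison

open Summit.BirchSwinnertonDyer.Rank1Residual.Additive.CorankOneFiniteOrderAutomorphism

namespace Summit.BirchSwinnertonDyer.Rank1Residual.Additive.RamifiedOrdinaryLineQuotientModelFree

/-! ## §1. The quotient `D = E[p^∞]/C` of a ramified ordinary line: `p`-primary, divisible, `#D[p] = p` -/

section Datum

variable {W : WeierstrassCurve ℚ} [W.IsElliptic] {p : ℕ} [hp : Fact p.Prime]
  {v : HeightOneSpectrum (𝓞 ℚ)} (L : LocalDatum ℚ (W.geomPrimaryTorsion p) v)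

omit [W.IsElliptic] hp in
/-- `E[p^∞]/C` is `p`-primary. [folklore] -/
theorem gr_pPrimary (d : L.Gr) : ∃ k : ℕ, p ^ k • d = 0 := by
  obtain ⟨m, rfl⟩ := L.grMk_surjective d
  obtain ⟨k, hk⟩ := RamifiedOrdinaryLineUnique.exists_pow_nsmul_eq_zero W p m
  exact ⟨k, by rw [← map_nsmul, hk, map_zero]⟩

/-- `E[p^∞]/C` is `p`-divisible (`E[p^∞]` is). [cite: SilvermanAEC2009, Prop. III.4.2(a)] -/
theorem gr_divisible (d : L.Gr) : ∃ d' : L.Gr, p • d' = d := by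
  obtain ⟨m, rfl⟩ := L.grMk_surjective d
  obtain ⟨m', hm'⟩ := X2.GreenbergVatsalTorsionCurve.divisible_curve W p m
  exact ⟨L.grMk m', by rw [← map_nsmul, hm']⟩

/-- **`#(E[p^∞]/C)[p] = p` for a ramified ordinary line `C`**: `E[p^∞][p] → (E[p^∞]/C)[p]` is onto
(`C` is `p`-divisible) with kernel `C ∩ E[p^∞][p]` of order `p` (`natCard_plus_inf_torsionBy_eq`), and
`#E[p^∞][p] = p²`. [cite: SilvermanAEC2009, Cor. III.6.4(b)]
[cite: EmertonPollackWeston2006, §3.1 (eq:ordes) (arXiv:math/0404484 p. 17)] -/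
theorem natCard_torsionBy_gr (hL : IsRamifiedOrdinaryLine W p L) : Nat.card ((L.Gr)[(p : ℤ)]) = p := by
  set T : AddSubgroup ↥(W.geomPrimaryTorsion p) := (↥(W.geomPrimaryTorsion p))[(p : ℤ)] with hT
  have hsq : Nat.card T = p ^ 2 := natCard_torsionBy_geomPrimaryTorsion (W := W) (p := p)
  have hCp : Nat.card ↥(L.plus ⊓ T) = p := AdditivePotMult.RamifiedLineUnique.natCard_plus_inf_torsionBy_eq hL
  -- the restriction `f : E[p^∞][p] → (E[p^∞]/C)[p]` of the quotient map
  have hmem : ∀ x : T, (L.grMk.comp T.subtype) x ∈ (L.Gr)[(p : ℤ)] := fun x ↦ by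
    rw [AddSubgroup.torsionBy.nsmul_iff, AddMonoidHom.comp_apply, ← map_nsmul,
      AddSubgroup.subtype_apply, AddSubgroup.torsionBy.nsmul_iff.mp x.2, map_zero]
  set f : T →+ (L.Gr)[(p : ℤ)] := (L.grMk.comp T.subtype).codRestrict _ hmem with hf
  have hfx : ∀ x : T, ((f x : (L.Gr)[(p : ℤ)]) : L.Gr) = L.grMk (x : W.geomPrimaryTorsion p) :=
    fun _ ↦ rfl
  -- `f` is onto: `C` is `p`-divisible
  have hsurj : Function.Surjective f := by
    rintro ⟨y, hy⟩
    obtain ⟨m, rfl⟩ := L.grMk_surjective y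
    have hpm : p • m ∈ L.plus := by
      rw [← L.ker_grMk, AddMonoidHom.mem_ker, map_nsmul]
      exact AddSubgroup.torsionBy.nsmul_iff.mp hy
    obtain ⟨c, hc, hpc⟩ := hL.divisible hpm
    refine ⟨⟨m - c, ?_⟩, Subtype.ext ?_⟩
    · rw [AddSubgroup.torsionBy.nsmul_iff, nsmul_sub, hpc, sub_self]
    · rw [hfx, map_sub, sub_eq_self, ← AddMonoidHom.mem_ker, L.ker_grMk]
      exact hc
  -- `ker f = C ∩ E[p^∞][p]`
  have hker : f.ker = (L.plus ⊓ T).addSubgroupOf T := by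
    ext x
    rw [AddMonoidHom.mem_ker, AddSubgroup.mem_addSubgroupOf, AddSubgroup.mem_inf]
    constructor
    · intro h
      refine ⟨?_, x.2⟩
      rw [← L.ker_grMk, AddMonoidHom.mem_ker, ← hfx, h, ZeroMemClass.coe_zero]
    · rintro ⟨h, -⟩
      apply Subtype.ext
      rw [hfx, ZeroMemClass.coe_zero, ← AddMonoidHom.mem_ker, L.ker_grMk]
      exact h
  -- count: `p² = #(E[p^∞]/C)[p] · p`
  have h1 : Nat.card T = Nat.card (T ⧸ f.ker) * Nat.card f.ker :=
    AddSubgroup.card_eq_card_quotient_mul_card_addSubgroup f.ker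
  have h2 : Nat.card (T ⧸ f.ker) = Nat.card ((L.Gr)[(p : ℤ)]) :=
    Nat.card_congr (QuotientAddGroup.quotientKerEquivOfSurjective f hsurj).toEquiv
  have h3 : Nat.card f.ker = p := by
    rw [hker, Nat.card_congr (AddSubgroup.addSubgroupOfEquivOfLe inf_le_right).toEquiv]
    exact hCp
  rw [hsq, h2, h3, pow_two] at h1
  exact (Nat.eq_of_mul_eq_mul_right hp.out.pos h1).symm

end Datum

/-! ## §2. An inertia element of the tower acting non-trivially on `D[p]`; the main theorem -/

section Main

variable {W : WeierstrassCurve ℚ} [W.IsElliptic] {p : ℕ} [hp : Fact p.Prime]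
  {v : HeightOneSpectrum (𝓞 ℚ)} {L : LocalDatum ℚ (W.geomPrimaryTorsion p) v}

omit [W.IsElliptic] hp in
/-- Clause 4 of `IsRamifiedOrdinaryLine` read on the quotient: some `n ≥ 1` with `σⁿ = 1` on
`E[p^∞]/C` for every local inertia element `σ`.
[cite: EmertonPollackWeston2006, §3.1 (eq:ordes) (arXiv:math/0404484 p. 17)] -/
theorem exists_forall_inertia_pow_smul_gr_eq (hL : IsRamifiedOrdinaryLine W p L) :
    ∃ n : ℕ, 0 < n ∧ ∀ (σ : absoluteGaloisGroup (v.adicCompletion ℚ)),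
      σ ∈ absInertia (v.adicCompletion ℚ) → ∀ d : L.Gr,
        (⟨absGaloisRestrict ℚ (v.adicCompletion ℚ) σ, σ, rfl⟩ : decomp v) ^ n • d = d := by
  obtain ⟨-, -, -, ⟨n, hn, hN⟩, -⟩ := id hL
  refine ⟨n, hn, fun σ hσ d ↦ ?_⟩
  obtain ⟨m, rfl⟩ := L.grMk_surjective d
  rw [LocalDatum.smul_grMk, Subgroup.coe_pow, ← sub_eq_zero, ← map_sub, ← AddMonoidHom.mem_ker,
    L.ker_grMk]
  exact hN σ hσ m

/-- **Clause 5's inertia element acts NON-trivially on `(E[p^∞]/C)[p]`** (`p` odd): an inertia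
element `σ₀` moving some point of `D = E[p^∞]/C` moves some `p`-torsion point of `D` — otherwise, `D`
being `p`-divisible `p`-primary with `#D[p] = p` and `σ₀ⁿ = 1` on `D` (clause 4), FILE A1's (L4) would make
`σ₀` trivial on `D`. [cite: EmertonPollackWeston2006, §3.1 (eq:ordes) (arXiv:math/0404484 p. 17)] -/
theorem exists_inertia_smul_torsionBy_ne (hp2 : p ≠ 2) (hL : IsRamifiedOrdinaryLine W p L) :
    ∃ σ ∈ absInertia (v.adicCompletion ℚ), ∃ d : L.Gr, p • d = 0 ∧
      (⟨absGaloisRestrict ℚ (v.adicCompletion ℚ) σ, σ, rfl⟩ : decomp v) • d ≠ d := by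
  obtain ⟨-, -, -, -, ⟨σ₀, hσ₀, m₀, hm₀⟩⟩ := id hL
  obtain ⟨n, hn, hN⟩ := exists_forall_inertia_pow_smul_gr_eq hL
  refine ⟨σ₀, hσ₀, ?_⟩
  by_contra! h
  have hall : ∀ d : L.Gr,
      (⟨absGaloisRestrict ℚ (v.adicCompletion ℚ) σ₀, σ₀, rfl⟩ : decomp v) • d = d :=
    smul_eq_self_of_pow_smul_eq_self p hp2 (gr_pPrimary L) (gr_divisible L)
      (natCard_torsionBy_gr L hL) h hn.ne' (hN σ₀ hσ₀)
  apply hm₀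
  rw [← L.ker_grMk, AddMonoidHom.mem_ker, map_sub, sub_eq_zero]
  have h0 := hall (L.grMk m₀)
  rw [LocalDatum.smul_grMk] at h0
  exact h0

/-- **An inertia element INSIDE `ker κ` acting non-trivially on `(E[p^∞]/C)[p]`** (`p` odd, any
`ℤ_p`-extension `κ`): with `σ₀` as above, `σ₁ ∈ I_{ℚ_v}` with `(p−1)·κ(res σ₁) = κ(res σ₀)`
(`exists_mem_absInertia_toAdd_eq_mul`: the image of `I_{ℚ_v}` in `ℤ_p` is a `ℤ_p`-submodule;
`p − 1 ∈ ℤ_pˣ`) and `τ = σ₀ σ₁^{−(p−1)}`: `κ(res τ) = 0` and `σ₁^{p−1}` fixes the cyclic `D[p]`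
(Fermat), so `τ` acts on `D[p]` as `σ₀`. [cite: GreenbergVatsal2000, §2 Remark (2.9)] -/
theorem exists_inertia_mem_kerSubgroup_smul_torsionBy_ne (hp2 : p ≠ 2)
    (hL : IsRamifiedOrdinaryLine W p L) (κ : ZpExtension ℚ p) :
    ∃ τ ∈ absInertia (v.adicCompletion ℚ),
      absGaloisRestrict ℚ (v.adicCompletion ℚ) τ ∈ κ.kerSubgroup ∧ ∃ d : L.Gr, p • d = 0 ∧
        (⟨absGaloisRestrict ℚ (v.adicCompletion ℚ) τ, τ, rfl⟩ : decomp v) • d ≠ d := by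
  obtain ⟨σ₀, hσ₀, d₁, hd₁p, hσd₁⟩ := exists_inertia_smul_torsionBy_ne hp2 hL
  have hd₁ : d₁ ≠ 0 := fun h ↦ hσd₁ (by rw [h, smul_zero])
  have hord : addOrderOf d₁ = p := addOrderOf_eq_prime hd₁p hd₁
  have hcard' : Nat.card ↥((⊤ : AddSubgroup L.Gr) ⊓ (L.Gr)[(p : ℤ)]) = p := by
    rw [top_inf_eq]; exact natCard_torsionBy_gr L hL
  -- `p − 1 ∈ ℤ_pˣ`; `σ₁` with `(p − 1) κ(res σ₁) = κ(res σ₀)`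
  have he : IsUnit (((p - 1 : ℕ)) : ℤ_[p]) := PadicCharacter.isUnit_natCast_of_not_dvd
    (Nat.not_dvd_of_pos_of_lt (by have := hp.out.two_le; omega) (Nat.sub_lt hp.out.pos one_pos))
  obtain ⟨w, hw⟩ := he.exists_left_inv
  obtain ⟨σ₁, hσ₁, hκ₁⟩ := exists_mem_absInertia_toAdd_eq_mul κ v hσ₀ w
  set δ₀ : decomp v := ⟨absGaloisRestrict ℚ (v.adicCompletion ℚ) σ₀, σ₀, rfl⟩ with hδ₀
  set δ₁ : decomp v := ⟨absGaloisRestrict ℚ (v.adicCompletion ℚ) σ₁, σ₁, rfl⟩ with hδ₁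
  -- `σ₁^{p−1}` fixes `d₁`
  have hfix : δ₁ ^ (p - 1) • d₁ = d₁ := by
    obtain ⟨c, hc⟩ := RamifiedOrdinaryLineUniqueModelFree.exists_nsmul_eq_of_pTorsion_of_natCard p
      (⊤ : AddSubgroup L.Gr) hcard' trivial hd₁p hd₁ (t := δ₁ • d₁) trivial
      (by rw [smul_comm, hd₁p, smul_zero])
    rw [pow_smul_eq_pow_nsmul hc]
    by_cases hpc : p ∣ c
    · exfalso
      apply hd₁
      rw [← smul_eq_zero_iff_eq δ₁, hc, ← addOrderOf_dvd_iff_nsmul_eq_zero, hord]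
      exact hpc
    · have hF : c ^ (p - 1) ≡ 1 [MOD p] := by
        rw [← Nat.totient_prime hp.out]
        exact Nat.ModEq.pow_totient ((Nat.Prime.coprime_iff_not_dvd hp.out).mpr hpc).symm
      rw [← mod_addOrderOf_nsmul, hord, hF, Nat.mod_eq_of_lt hp.out.one_lt, one_nsmul]
  refine ⟨σ₀ * (σ₁ ^ (p - 1))⁻¹,
    (absInertia _).mul_mem hσ₀ ((absInertia _).inv_mem ((absInertia _).pow_mem hσ₁ _)),
    ?_, d₁, hd₁p, ?_⟩
  · -- `κ(res τ) = 1`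
    rw [ZpExtension.mem_kerSubgroup, map_mul, map_inv, map_pow, map_mul, map_inv, map_pow]
    apply Multiplicative.toAdd.injective
    rw [toAdd_mul, toAdd_inv, toAdd_pow, toAdd_one, hκ₁, nsmul_eq_mul]
    linear_combination
      (-(Multiplicative.toAdd (κ (absGaloisRestrict ℚ (v.adicCompletion ℚ) σ₀)))) * hw
  · -- `τ` acts on `d₁` as `σ₀`
    have hδ : (⟨absGaloisRestrict ℚ (v.adicCompletion ℚ) (σ₀ * (σ₁ ^ (p - 1))⁻¹), _, rfl⟩ :
        decomp v) = δ₀ * (δ₁ ^ (p - 1))⁻¹ := by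
      apply Subtype.ext
      change absGaloisRestrict ℚ (v.adicCompletion ℚ) (σ₀ * (σ₁ ^ (p - 1))⁻¹) = _
      rw [map_mul, map_inv, map_pow, Subgroup.coe_mul, Subgroup.coe_inv, Subgroup.coe_pow]
    rw [hδ, mul_smul, inv_smul_eq_iff.mpr hfix.symm]
    exact hσd₁

/-- **GV Remark (2.9)'s hypothesis, MODEL-FREE: `(E[p^∞]/C)^{ker κ ⊓ I_v} = 0` for EVERY ramified
ordinary line.** `E/ℚ` elliptic, `p` an odd prime, `v` a finite place, `L` ANY ramified ordinary line
of `E[p^∞]` at `v` (cc-typer-1's `IsRamifiedOrdinaryLine W p L`: `C = L.plus` divisible, `≠ 0`,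
`≠ E[p^∞]`, inertia acting on `E[p^∞]/C` through a finite quotient, non-trivially), `κ` ANY
`ℤ_p`-extension of `ℚ`: every element of `D = E[p^∞]/C` fixed by `ker κ ⊓ I_v` (the inertia group of
the tower's top field at the chosen prime above `v`) is `0`. No class hypothesis, no semistability
defect, no twist model, no Tate uniformisation, no irreducibility. This is the displayed binder `h0`
of `GreenbergVatsalTorsionRamified.*` / `GreenbergVatsalTransferRamified.*` (GV Remark (2.9): "all that
is needed in the proof is that `H⁰(I_p, D)` is divisible. Thus, if `D^{I_p} = 0`, the conclusion is
still true") for EVERY such datum, in particular on the `e ∈ {3, 4, 6}` rows.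
[cite: GreenbergVatsal2000, §2 Remark (2.9)]
[cite: EmertonPollackWeston2006, §3.1 (eq:ordes) (arXiv:math/0404484 p. 17)] -/
theorem gr_invariants_eq_zero_of_isRamifiedOrdinaryLine (hp2 : p ≠ 2)
    (hL : IsRamifiedOrdinaryLine W p L) (κ : ZpExtension ℚ p) :
    ∀ a ∈ invariants (inertiaIn κ.kerSubgroup v) L.Gr, a = 0 := by
  obtain ⟨τ, hτ, hτκ, d₁, hd₁p, hτd₁⟩ := exists_inertia_mem_kerSubgroup_smul_torsionBy_ne hp2 hL κ
  intro a ha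
  set δ : decomp v := ⟨absGaloisRestrict ℚ (v.adicCompletion ℚ) τ, τ, rfl⟩ with hδ
  have hδI : (δ : absoluteGaloisGroup ℚ) ∈ inertia v := Subgroup.mem_map.2 ⟨τ, hτ, rfl⟩
  let xI : inertiaIn κ.kerSubgroup v := ⟨δ, (mem_inertiaIn_iff _ v _).2 ⟨hτκ, hδI⟩⟩
  have hfix : δ • a = a := (mem_invariants_iff _).1 ha xI
  exact eq_zero_of_smul_eq_self_of_torsionBy p (gr_pPrimary L)
    (fun x hx hgx ↦ eq_zero_of_torsionBy_of_smul_eq_self p (natCard_torsionBy_gr L hL) hd₁p hτd₁ hx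
      hgx) hfix

/-- **The `Data`-family form** (the shape of the binder `h0` of the transfer files
`GreenbergVatsalTorsionRamified.*` / `GreenbergVatsalTransferRamified.*`): for a family of ramified
ordinary lines `L v hv` at the places `v ∋ p`, every `(E[p^∞]/C_v)^{ker κ ⊓ I_v}` vanishes.
[cite: GreenbergVatsal2000, §2 Remark (2.9)] -/
theorem data_gr_invariants_eq_zero_of_isRamifiedOrdinaryLine (hp2 : p ≠ 2) (κ : ZpExtension ℚ p)
    (Lf : Data ℚ (W.geomPrimaryTorsion p) p)
    (hLf : ∀ (v : HeightOneSpectrum (𝓞 ℚ)) (hv : ((p : ℕ) : 𝓞 ℚ) ∈ v.asIdeal),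
      IsRamifiedOrdinaryLine W p (Lf v hv)) :
    ∀ (v : HeightOneSpectrum (𝓞 ℚ)) (hv : ((p : ℕ) : 𝓞 ℚ) ∈ v.asIdeal),
      ∀ a ∈ invariants (inertiaIn κ.kerSubgroup v) (Lf v hv).Gr, a = 0 :=
  fun v hv ↦ gr_invariants_eq_zero_of_isRamifiedOrdinaryLine hp2 (hLf v hv) κ

end Main

end Summit.BirchSwinnertonDyer.Rank1Residual.Additive.RamifiedOrdinaryLineQuotientModelFree

end
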